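import Summits.HodgeConjecture.HodgeConjecture.Theses.ELineTransport
import Literature.AlgebraicGeometry.Motives.SegreEmbedding

/-!
# Route ELineTransport — `FrameOfSummit` (support item stmt-HodgeConjecture-12556)

`HodgeConjecture → RMSquares`: the sector statement concludes `HodgeConjectureFor 4 (S ⊗ S)` for
certain smooth projective surfaces `S`; the Hodge conjecture gives it at once, the self-product being
smooth projective of dimension `2 + 2` (`IsSmoothProjective.tensor_holds`, Segre embedding).  All the
other hypotheses of `RMSquares` are idle.  No named-fact hypothesis, no sorry.
-/

-- `Summit.HodgeConjecture.HodgeConjecture.Theorems` is the mandated namespace (single-problem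
-- summit: Problem = Summit), which `linter.dupNamespace` flags on every declaration; the lakefile
-- turns the linter off tree-wide (weak option), restated here so stand-alone elaboration is
-- warning-free too.
set_option linter.dupNamespace false

namespace Summit.HodgeConjecture.HodgeConjecture.Theorems

open Literature.AlgebraicGeometry.Motives

/-- **Item stmt-HodgeConjecture-12556 (`FrameOfSummit`), route `ELineTransport`**: the summit implies
the sector — apply the Hodge conjecture to the smooth projective fourfold `S ⊗ S`
(`IsSmoothProjective.tensor_holds`). [cite: Hartshorne1977, III Prop. 10.1 (d) and II Ex. 4.9] -/
theorem eLineTransport_frameOfSummit_proof :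
    Summit.HodgeConjecture.HodgeConjecture.Theses.ELineTransport.FrameOfSummit :=
  fun hHC _S hS _m _hm _J _hJ _hψ _hv ↦ hHC (IsSmoothProjective.tensor_holds hS.1 hS.1)

end Summit.HodgeConjecture.HodgeConjecture.Theorems
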